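import Summits.CriticalPhenomena.PercolationContinuityZ3.Theorems.PercNearOneGluingNoHeavyLowerTailOneCutCertAssembly
import Summits.CriticalPhenomena.PercolationContinuityZ3.Theorems.PercNearOneGluingNoHeavyLowerTailLonelyRelay

/-!
# `NoHeavyLowerTail` (crux stmt-CriticalPhenomena-4575), one-cut bound at `|A| = 5` on at most six
# vertices: reduction of the general statement to the eight canonical certificate instances

Assembly layer (part 2) for `oneCut5_le_six` (prim-cert-2).  `oneCut5_le_six_of`: the one-cut bound
`P(1 ≤ N < E N/2) ≤ max_{a≠a'} P(a ↮ a')` for every weighted graph on `n ≤ 6` vertices and every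
relay set `A` with `|A| = 5` FOLLOWS from the canonical box statements
* `BoxOK k` (`k ≤ 5`): observer `0 ∉ A = {1,…,5}`, the `k` o-edges `01,…,0k` with weight in `[½,1]`,
  the others in `[0,½]` (strict interior), all relay–relay weights free;
* `CanonOK5`: `n = 5`, observer `0 ∈ A = univ`; `CanonOK6`: `n = 6`, observer `0 ∈ A = {0,…,4}`.
Ingredients: `E N ≤ 4` is the tree's `oneCut_of_sum_le_four`; for `E N > 4` the event is
`{1 ≤ N ≤ 2}`; relabelling (`OC5.of_relabel`) moves `o` to `0` (and the Steiner vertex to `5`) and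
sorts the o-edge pattern; genericity by density (`OC5.of_generic`).  The canonical statements are
discharged by the COMPUTATIONAL instance files (`…OneCutCertBox*`, `…OneCutCertK5oA`, `…K6oA`).

Nothing here asserts the crux.
-/

namespace Summit.CriticalPhenomena.PercolationContinuityZ3.Theorems.OneCutCert

open MeasureTheory Filter Topology
open scoped BigOperators Classical
open Literature.Probability.Percolation Literature.Probability.LatticeModels
open Summit.CriticalPhenomena.PercolationContinuityZ3.Theorems.AdditiveGluing.Negative.Cert

/-! ## The canonical statements -/

/-- The canonical relay list `1,…,5` of `Fin 6`. [this work] -/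
def rel6 : List (Fin 6) := [1, 2, 3, 4, 5]

/-- The box with the first `k` o-edges high. [this work] -/
def boxPat (k : ℕ) (i : Fin (mE 6)) : Fin 3 :=
  if i.val < 5 then (if i.val < k then 2 else 1) else 0

/-- The canonical box statement: `0 ∉ A = {1,…,5}`, o-edges `0j` high for `j ≤ k`, low otherwise. [this work] -/
def BoxOK (k : ℕ) : Prop :=
  ∀ w : Sym2 (Fin 6) → unitInterval,
    (∀ i, loOf (boxPat k i) < xOf w i ∧ xOf w i < hiOf (boxPat k i)) →
    4 < ∑ a ∈ rel6.toFinset, (prodBernoulli w).real (openConn 0 a) → ∀ t : ℝ,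
    (∀ p ∈ relPairs rel6, (prodBernoulli w).real (openConn p.1 p.2)ᶜ ≤ t) →
    (prodBernoulli w).real {ω : BondConfig (Fin 6) |
        1 ≤ (rel6.toFinset.filter fun a => ω ∈ openConn 0 a).card ∧
          (rel6.toFinset.filter fun a => ω ∈ openConn 0 a).card ≤ 2} ≤ t

/-- The canonical statement for `n` vertices, observer `0 ∈ A = rel.toFinset`, the full open cube. [this work] -/
def CanonOK (n : ℕ) (rel : List (Fin n)) (o : Fin n) : Prop :=
  ∀ w : Sym2 (Fin n) → unitInterval,
    (∀ i, 0 < xOf w i ∧ xOf w i < 1) →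
    4 < ∑ a ∈ rel.toFinset, (prodBernoulli w).real (openConn o a) → ∀ t : ℝ,
    (∀ p ∈ relPairs rel, (prodBernoulli w).real (openConn p.1 p.2)ᶜ ≤ t) →
    (prodBernoulli w).real {ω : BondConfig (Fin n) |
        1 ≤ (rel.toFinset.filter fun a => ω ∈ openConn o a).card ∧
          (rel.toFinset.filter fun a => ω ∈ openConn o a).card ≤ 2} ≤ t

/-! ## Finite facts about the coordinates (by `decide`) -/

/-- Members of `relPairs` are distinct members of the list. [this work] -/
theorem relPairs_mem {n : ℕ} : ∀ (l : List (Fin n)) (p : Fin n × Fin n), p ∈ relPairs l →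
    p.1 ∈ l ∧ p.2 ∈ l ∧ (l.Nodup → p.1 ≠ p.2)
  | [], p, hp => by simp [relPairs] at hp
  | a :: l, p, hp => by
    simp only [relPairs, List.mem_append, List.mem_map] at hp
    rcases hp with ⟨b, hb, rfl⟩ | hp
    · refine ⟨List.mem_cons_self, List.mem_cons_of_mem _ hb, fun hnd h => ?_⟩
      rw [List.nodup_cons] at hnd
      have h' : a = b := h
      rw [← h'] at hb
      exact hnd.1 hb
    · obtain ⟨h1, h2, h3⟩ := relPairs_mem l p hp
      exact ⟨List.mem_cons_of_mem _ h1, List.mem_cons_of_mem _ h2,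
        fun hnd => h3 (List.nodup_cons.1 hnd).2⟩

/-- The first five coordinates of `Fin 6` are the o-edges `s(0, i+1)`, the others miss `0` and are
non-diagonal. [this work] -/
theorem edgeE_six (i : Fin (mE 6)) :
    (i.val < 5 → edgeE 6 i = s((0 : Fin 6), ⟨(i.val + 1) % 6, Nat.mod_lt _ (by norm_num)⟩)) ∧
    ¬ (edgeE 6 i).IsDiag := by
  revert i; decide

/-- Sorting a `0/1` pattern on `{1,…,5}` by a permutation fixing `0`. [this work] -/
theorem exists_sortPerm (c : Fin 6 → Bool) :
    ∃ σ : Equiv.Perm (Fin 6), σ 0 = 0 ∧ ∀ j : Fin 6, j ≠ 0 →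
      ((σ j).val ≤ (Finset.univ.filter fun j : Fin 6 => j ≠ 0 ∧ c j = true).card ↔ c j = true) := by
  revert c; native_decide

/-! ## The canonical `K6` statement for generic weights -/

/-- From the six boxes to every GENERIC weight vector (observer `0`, relays `1,…,5`). [this work] -/
theorem canonK6 (hK : ∀ k, k ≤ 5 → BoxOK k) (w : Sym2 (Fin 6) → unitInterval) (hw : Generic w) :
    OC5 w rel6.toFinset 0 := by
  -- the high pattern and its sorting permutation
  set c : Fin 6 → Bool := fun j => decide ((1 : ℝ) / 2 < (w s(0, j) : ℝ)) with hc
  obtain ⟨σ, hσ0, hσ⟩ := exists_sortPerm c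
  set k := (Finset.univ.filter fun j : Fin 6 => j ≠ 0 ∧ c j = true).card with hk
  have hk5 : k ≤ 5 := by
    have : (Finset.univ.filter fun j : Fin 6 => j ≠ 0 ∧ c j = true) ⊆ Finset.univ.erase 0 := by
      intro j hj; rw [Finset.mem_filter] at hj; exact Finset.mem_erase.2 ⟨hj.2.1, Finset.mem_univ _⟩
    exact (Finset.card_le_card this).trans (by decide)
  -- relabel
  have hA : rel6.toFinset.map σ.toEmbedding = rel6.toFinset := by
    have h1 : rel6.toFinset = Finset.univ.erase (0 : Fin 6) := by decide
    rw [h1, Finset.map_erase, Finset.map_univ_equiv, Equiv.coe_toEmbedding, hσ0]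
  have key : OC5 (relabelW σ w) (rel6.toFinset.map σ.toEmbedding) (σ 0) := by
    rw [hA, hσ0]
    intro hEN t hcut
    refine hK k hk5 (relabelW σ w) (fun i => ?_) hEN t fun p hp => ?_
    · -- the box condition
      obtain ⟨hi5, hnd⟩ := edgeE_six i
      have hgen : ∀ e : Sym2 (Fin 6), ¬ e.IsDiag →
          0 < (relabelW σ w e : ℝ) ∧ (relabelW σ w e : ℝ) < 1 ∧ (relabelW σ w e : ℝ) ≠ 1 / 2 := by
        intro e he
        have hne : ¬ ((sym2Equiv σ).symm e).IsDiag := by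
          rw [sym2Equiv_symm]
          induction e using Sym2.ind with
          | _ x y => rw [sym2Equiv_mk, Sym2.mk_isDiag_iff, σ.symm.injective.eq_iff]; rwa [Sym2.mk_isDiag_iff] at he
        obtain ⟨h0, hhalf, h1⟩ := hw _ hne
        have hge := ((w ((sym2Equiv σ).symm e)).2.1); have hle := ((w ((sym2Equiv σ).symm e)).2.2)
        exact ⟨lt_of_le_of_ne hge (Ne.symm h0), lt_of_le_of_ne hle h1, hhalf⟩
      obtain ⟨hx0, hx1, hxh⟩ := hgen (edgeE 6 i) hnd
      unfold xOf boxPat loOf hiOf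
      by_cases hi : i.val < 5
      · -- o-edge `s(0, i+1)`: high iff `i < k`
        have hed := hi5 hi
        set j : Fin 6 := σ.symm ⟨(i.val + 1) % 6, Nat.mod_lt _ (by norm_num)⟩ with hj
        have hmod : (i.val + 1) % 6 = i.val + 1 := Nat.mod_eq_of_lt (by omega)
        have hj0 : j ≠ 0 := by
          intro h
          have := congrArg σ h
          rw [hj, Equiv.apply_symm_apply, hσ0] at this
          have := congrArg Fin.val this
          simp only [Fin.val_zero] at this
          omega
        have hval : relabelW σ w (edgeE 6 i) = w s(0, j) := by
          unfold relabelW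
          rw [hed, sym2Equiv_symm, sym2Equiv_mk]
          congr 1
          rw [Sym2.eq_iff]; left
          exact ⟨by rw [Equiv.symm_apply_eq]; exact hσ0.symm, rfl⟩
        have hiff := hσ j hj0
        rw [hj, Equiv.apply_symm_apply] at hiff
        -- `i < k ↔ c j`
        have hik : i.val < k ↔ c j = true := by
          rw [← hiff]; show i.val < k ↔ (i.val + 1) % 6 ≤ k; rw [hmod]; omega
        rw [hval] at hx0 hx1 hxh ⊢
        simp only [hi, if_true]
        by_cases hck : i.val < k
        · have hcj : (1 : ℝ) / 2 < (w s(0, j) : ℝ) := by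
            have := hik.1 hck; simpa [hc] using this
          simp only [hck, if_true, show (2 : Fin 3).val = 2 from rfl]
          norm_num
          exact ⟨hcj, hx1⟩
        · have hcj : ¬ (1 : ℝ) / 2 < (w s(0, j) : ℝ) := by
            intro h; exact hck (hik.2 (by simpa [hc] using h))
          simp only [hck, if_false, show (1 : Fin 3).val = 1 from rfl]
          norm_num
          exact ⟨hx0, lt_of_le_of_ne (not_lt.1 hcj) hxh⟩
      · simp only [hi, if_false, show (0 : Fin 3).val = 0 from rfl]
        norm_num
        exact ⟨hx0, hx1⟩
    · obtain ⟨h1, h2, h3⟩ := relPairs_mem rel6 p hp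
      exact hcut p.1 (List.mem_toFinset.2 h1) p.2 (List.mem_toFinset.2 h2) (h3 (by decide))
  exact OC5.of_relabel σ w _ 0 key

/-- The canonical statement with `o ∈ A` and the full open cube, for generic weights. [this work] -/
theorem canonOA {n : ℕ} (rel : List (Fin n)) (hrel : rel.Nodup) (o : Fin n) (h : CanonOK n rel o)
    (w : Sym2 (Fin n) → unitInterval) (hw : Generic w) : OC5 w rel.toFinset o := by
  intro hEN t hcut
  refine h w (fun i => ?_) hEN t fun p hp => ?_
  · have hnd : ¬ (edgeE n i).IsDiag := (mem_range_edgeE (edgeE n i)).1 ⟨i, rfl⟩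
    obtain ⟨h0, _, h1⟩ := hw _ hnd
    exact ⟨lt_of_le_of_ne (w _).2.1 (Ne.symm h0), lt_of_le_of_ne (w _).2.2 h1⟩
  · obtain ⟨h1, h2, h3⟩ := relPairs_mem rel p hp
    exact hcut p.1 (List.mem_toFinset.2 h1) p.2 (List.mem_toFinset.2 h2) (h3 hrel)

/-! ## The reduction -/

/-- **One-cut at `|A| = 5` on at most six vertices, from the canonical certificate statements.**
[this work] -/
theorem oneCut5_le_six_of (hK : ∀ k, k ≤ 5 → BoxOK k) (h5 : CanonOK 5 [0, 1, 2, 3, 4] 0)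
    (h6 : CanonOK 6 [0, 1, 2, 3, 4] 0) :
    ∀ (n : ℕ), n ≤ 6 → ∀ (w : Sym2 (Fin n) → unitInterval) (A : Finset (Fin n)) (o : Fin n) (t : ℝ),
      A.card = 5 → 0 ≤ t →
      (∀ a ∈ A, ∀ a' ∈ A, a ≠ a' →
        (prodBernoulli w).real (openConn a a')ᶜ ≤ t) →
      (prodBernoulli w).real {ω : BondConfig (Fin n) |
          1 ≤ (A.filter fun a => ω ∈ openConn o a).card ∧
          ((A.filter fun a => ω ∈ openConn o a).card : ℝ) <
            (∑ a ∈ A, (prodBernoulli w).real (openConn o a)) / 2} ≤ t := by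
  intro n hn w A o t hA ht hpair
  by_cases hEN : (∑ a ∈ A, (prodBernoulli w).real (openConn o a)) ≤ 4
  · exact oneCut_of_sum_le_four n w A o t hEN ht hpair
  push Not at hEN
  -- `E N ≤ 5`, so the event is `{1 ≤ N ≤ 2}`
  have hEN5 : (∑ a ∈ A, (prodBernoulli w).real (openConn o a)) ≤ 5 := by
    calc (∑ a ∈ A, (prodBernoulli w).real (openConn o a)) ≤ ∑ _a ∈ A, (1 : ℝ) :=
          Finset.sum_le_sum fun a _ => measureReal_le_one
      _ = A.card := by simp
      _ = 5 := by rw [hA]; norm_num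
  have hev : {ω : BondConfig (Fin n) | 1 ≤ (A.filter fun a => ω ∈ openConn o a).card ∧
      ((A.filter fun a => ω ∈ openConn o a).card : ℝ) < (∑ a ∈ A, (prodBernoulli w).real (openConn o a)) / 2}
      = {ω : BondConfig (Fin n) | 1 ≤ (A.filter fun a => ω ∈ openConn o a).card ∧
          (A.filter fun a => ω ∈ openConn o a).card ≤ 2} := by
    ext ω
    simp only [Set.mem_setOf_eq]
    refine and_congr_right fun _ => ⟨fun h => ?_, fun h => ?_⟩
    · have : ((A.filter fun a => ω ∈ openConn o a).card : ℝ) < 3 := by linarith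
      exact_mod_cast Nat.lt_succ_iff.1 (by exact_mod_cast this)
    · have : ((A.filter fun a => ω ∈ openConn o a).card : ℝ) ≤ 2 := by exact_mod_cast h
      linarith
  rw [hev]
  -- it remains to prove `OC5 w A o`
  suffices hOC : OC5 w A o from hOC hEN t hpair
  have hn5 : 5 ≤ n := by
    have := Finset.card_le_univ A; rw [hA, Fintype.card_fin] at this; exact this
  by_cases hoA : o ∈ A
  · -- observer among the relays
    rcases Nat.lt_or_ge n 6 with hlt | hge
    · -- `n = 5`, `A = univ`
      obtain rfl : n = 5 := by omega
      have hAu : A = Finset.univ := Finset.eq_univ_of_card A (by rw [hA]; rfl)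
      set σ : Equiv.Perm (Fin 5) := Equiv.swap o 0 with hσ
      have hσo : σ o = 0 := Equiv.swap_apply_left o 0
      refine OC5.of_relabel σ w A o ?_
      have hmap : A.map σ.toEmbedding = ([0, 1, 2, 3, 4] : List (Fin 5)).toFinset := by
        rw [hAu, Finset.map_univ_equiv]; decide
      rw [hmap, hσo]
      exact OC5.of_generic _ _ (canonOA _ (by decide) 0 h5) _
    · -- `n = 6`, one Steiner vertex `s`
      obtain rfl : n = 6 := by omega
      obtain ⟨s, hs⟩ : ∃ s, s ∉ A := by
        by_contra hall; push Not at hall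
        have : A = Finset.univ := Finset.eq_univ_iff_forall.2 hall
        rw [this, Finset.card_univ, Fintype.card_fin] at hA; exact absurd hA (by norm_num)
      have hso : s ≠ o := fun h => hs (h ▸ hoA)
      set τ : Equiv.Perm (Fin 6) := Equiv.swap o 0 with hτ
      set σ : Equiv.Perm (Fin 6) := (Equiv.swap (τ s) 5).trans (Equiv.refl _) |>.symm.symm with hσ'
      -- simpler: σ := swap (τ s) 5 ∘ τ
      set ρ : Equiv.Perm (Fin 6) := τ.trans (Equiv.swap (τ s) 5) with hρ
      have hτo : τ o = 0 := Equiv.swap_apply_left o 0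
      have hτs : τ s ≠ 0 := by rw [← hτo]; exact fun h => hso (τ.injective h)
      have hρo : ρ o = 0 := by
        show Equiv.swap (τ s) 5 (τ o) = 0
        rw [hτo, Equiv.swap_apply_of_ne_of_ne (Ne.symm hτs) (by decide)]
      have hρs : ρ s = 5 := by
        show Equiv.swap (τ s) 5 (τ s) = 5
        exact Equiv.swap_apply_left _ _
      refine OC5.of_relabel ρ w A o ?_
      have hAe : A = Finset.univ.erase s := by
        apply Finset.eq_of_subset_of_card_le
        · intro a ha; exact Finset.mem_erase.2 ⟨fun h => hs (h ▸ ha), Finset.mem_univ _⟩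
        · rw [Finset.card_erase_of_mem (Finset.mem_univ _), Finset.card_univ, Fintype.card_fin, hA]
      have hmap : A.map ρ.toEmbedding = ([0, 1, 2, 3, 4] : List (Fin 6)).toFinset := by
        rw [hAe, Finset.map_erase, Finset.map_univ_equiv, Equiv.coe_toEmbedding, hρs]; decide
      rw [hmap, hρo]
      exact OC5.of_generic _ _ (canonOA _ (by decide) 0 h6) _
  · -- observer outside: `n = 6`, `A = univ ∖ {o}`
    have h6 : 6 ≤ n := by
      have := Finset.card_le_univ (insert o A)
      rw [Finset.card_insert_of_notMem hoA, hA, Fintype.card_fin] at this; exact this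
    obtain rfl : n = 6 := by omega
    set σ : Equiv.Perm (Fin 6) := Equiv.swap o 0 with hσ
    have hσo : σ o = 0 := Equiv.swap_apply_left o 0
    refine OC5.of_relabel σ w A o ?_
    have hAe : A = Finset.univ.erase o := by
      apply Finset.eq_of_subset_of_card_le
      · intro a ha; exact Finset.mem_erase.2 ⟨fun h => hoA (h ▸ ha), Finset.mem_univ _⟩
      · rw [Finset.card_erase_of_mem (Finset.mem_univ _), Finset.card_univ, Fintype.card_fin, hA]
    have hmap : A.map σ.toEmbedding = rel6.toFinset := by
      rw [hAe, Finset.map_erase, Finset.map_univ_equiv, Equiv.coe_toEmbedding, hσo]; decide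
    rw [hmap, hσo]
    exact OC5.of_generic _ _ (canonK6 hK) _

end Summit.CriticalPhenomena.PercolationContinuityZ3.Theorems.OneCutCert
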